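import Summits.MatrixMultiplication.MatrixMultiplication.Theorems.PairwiseCurvedTilingsLC.Negative.PairwiseCurvedTilingsLCFalseOfDefinableTranslateRecurrenceLC

/-!
# `PairwiseCurvedTilingsLC` (crux stmt-MatrixMultiplication-17883), line LonelyTranslates:
the shadow formula realises `⋃_x (B_x − C_x)` pointwise (set form, no finiteness)

Formula plumbing for the lead prover's line LonelyTranslates (crux-ideate k1's reduction, crux
directory `Cruxes/PairwiseCurvedTilingsLC/LonelyTranslates.lean` §3 and
`NEGATIVE-lonely-translates.md`).  The ring formula
`shadowFormula φI φB φC = ∃x ∃b ∃c, φ_I(x;y) ∧ φ_B(x,b;y) ∧ φ_C(x,c;y) ∧ ⋀_i w_i = b_i − c_i`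
and its realisation on FINITE families (`mem_bcShadow_iff_realize`) are already in the tree
(`PairwiseCurvedTilingsLCFalseOfDefinableTranslateRecurrenceLC.lean`, k2's recurrence-shaped
refutation).  The line's assembly applies the étale-open decomposition of Walsberg–Ye in an
INFINITE pseudo-finite field, where the realised family is a family of sets, so it needs the
pointwise statement with the memberships replaced by the `Realize` predicates:
`realize_shadowFormula_iff` (any compatible commutative ring) and, with the registered stub's exact
signature (fields), `stub_realize_shadowFormula_iff`.

Companion file: `LonelyTranslates.lean` (the combinatorial core, `PorosityShadowBound`, and
`notLC_of_shadowBound : PorosityShadowBound → ¬ PairwiseCurvedTilingsLC`).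
-/

set_option linter.dupNamespace false  -- `Summit.<S>.<S>.…` is the mandated namespace

namespace Summit.MatrixMultiplication.MatrixMultiplication.Theorems.PairwiseCurvedTilingsLC.Negative

open FirstOrder FirstOrder.Language FirstOrder.Ring

/-- **Realisation of the shadow formula, set form.**  For every compatible commutative ring `K`,
parameters `y` and point `w`:
`K ⊨ shadowFormula φI φB φC (w; y)` iff `w = b − c` for some `x` with `φ_I(x; y)`, some `b` with
`φ_B(x, b; y)` and some `c` with `φ_C(x, c; y)` — i.e. `w ∈ ⋃_{x ∈ I} (B_x − C_x)` for the realised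
(possibly infinite) family. -/
theorem realize_shadowFormula_iff {e m k : ℕ} {K : Type} [CommRing K] [CompatibleRing K]
    (φI : Language.ring.Formula (Fin e ⊕ Fin k))
    (φB φC : Language.ring.Formula ((Fin e ⊕ Fin m) ⊕ Fin k)) (y : Fin k → K) (w : Fin m → K) :
    (shadowFormula φI φB φC).Realize (Sum.elim w y) ↔
      ∃ x, φI.Realize (Sum.elim x y) ∧ ∃ b, φB.Realize (Sum.elim (Sum.elim x b) y) ∧
        ∃ c, φC.Realize (Sum.elim (Sum.elim x c) y) ∧ w = b - c := by
  simp only [shadowFormula, Formula.realize_iExs, Formula.realize_inf, Formula.realize_relabel,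
    realize_formula_iInf, Formula.realize_equal, Term.realize_var, Sum.elim_inl, Sum.elim_inr,
    FirstOrder.Ring.realize_add, FirstOrder.Ring.realize_neg]
  constructor
  · rintro ⟨g, ⟨⟨hx, hb⟩, hc⟩, hw⟩
    refine ⟨g ∘ Sum.inl, ?_, g ∘ Sum.inr ∘ Sum.inl, ?_, g ∘ Sum.inr ∘ Sum.inr, ?_, ?_⟩
    · convert hx using 2
      funext a; cases a <;> rfl
    · convert hb using 2
      funext a; rcases a with (a | a) | a <;> rfl
    · convert hc using 2
      funext a; rcases a with (a | a) | a <;> rfl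
    · funext i
      have := hw i
      simp only [Function.comp_apply, Pi.sub_apply]
      rw [this, sub_eq_add_neg]
  · rintro ⟨x, hx, b, hb, c, hc, rfl⟩
    refine ⟨Sum.elim x (Sum.elim b c), ⟨⟨?_, ?_⟩, ?_⟩, ?_⟩
    · convert hx using 2
      funext a; cases a <;> rfl
    · convert hb using 2
      funext a; rcases a with (a | a) | a <;> rfl
    · convert hc using 2
      funext a; rcases a with (a | a) | a <;> rfl
    · intro i
      simp [sub_eq_add_neg]

/-- STUB A′ of the line LonelyTranslates (registered as `stub_realize_shadowFormula_iff`), exact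
signature: over a field `K` with a compatible ring structure, `shadowFormula φI φB φC` realises
`⋃_{x ∈ I} (B_x − C_x)` pointwise, with no finiteness assumptions.  (`realize_shadowFormula_iff`
specialised to fields.) -/
theorem stub_realize_shadowFormula_iff {e m k : ℕ} {K : Type} [Field K] [CompatibleRing K]
    (φI : Language.ring.Formula (Fin e ⊕ Fin k))
    (φB φC : Language.ring.Formula ((Fin e ⊕ Fin m) ⊕ Fin k)) (y : Fin k → K) (w : Fin m → K) :
    (shadowFormula φI φB φC).Realize (Sum.elim w y) ↔
      ∃ x, φI.Realize (Sum.elim x y) ∧ ∃ b, φB.Realize (Sum.elim (Sum.elim x b) y) ∧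
        ∃ c, φC.Realize (Sum.elim (Sum.elim x c) y) ∧ w = b - c :=
  realize_shadowFormula_iff φI φB φC y w

end Summit.MatrixMultiplication.MatrixMultiplication.Theorems.PairwiseCurvedTilingsLC.Negative
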